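import Summits.KontsevichZagierPeriods.KontsevichZagierPeriods.Theses.HyperbolicBloch
import Literature.NumberTheory.Transcendental.KZKernelConjectureForms
import Literature.NumberTheory.Transcendental.KZProduct
import Literature.NumberTheory.Transcendental.KZCalculusProofs
import Literature.NumberTheory.Transcendental.KZLogCalculusProofs
import Summits.KontsevichZagierPeriods.KontsevichZagierPeriods.Theorems.ReducedPeriodRing.Negative.Certificates

/-!
# Disproof of `OffTetraSectorKernel` — work file of the standing disprover (cdisprove)

Crux item `stmt-KontsevichZagierPeriods-10557`, route `HyperbolicBloch`, decl
`Summit.KontsevichZagierPeriods.KontsevichZagierPeriods.Theses.HyperbolicBloch.OffTetraSectorKernel`: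
for the standard ideal-tetrahedron family `T`, every formal combination `c : KZ.FormalRep` with
`KZ.eval c = 0` lies in `KZ.relations ⊔ AddSubgroup.closure (tetraRelators T)`, where
`tetraRelators T` is the set of ℤ-combinations `Σ nᵢ•[ρ zᵢ]` of representations on the `T(zᵢ)`
(`zᵢ ∈ ℚ̄ ∩ ℍ⁺`, integrand `t⁻³`) with `Σ nᵢ·value = 0`.

## LANDED (gate-accepted) companions under `Theorems/OffTetraSectorKernel/Negative/`
* `LoadBearing.lean` (p78201): `sup_closure_le_ker`, `sup_closure_ne_top`,
  `offTetraSectorKernel_false_without_evalZero / _relations / _newtonLeibniz`,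
  `offTetraSectorKernelWithoutFamily_iff_kzKernelConjecture`, `not_offTetraSectorKernel_of_invariant`,
  `exists_invariant_of_not_offTetraSectorKernel`, `not_kontsevichZagierPeriods_of_not_offTetraSectorKernel`,
  `not_ker_le_closure_tetraRelators` (namespace
  `Summit.KontsevichZagierPeriods.HyperbolicBloch.OffTetraSectorKernelNegative`).
* `SliceCore.lean` (p78755): `setIntegral_band_eq_of_hasDerivAt`, `sliceWindow`, `sliceFun`,
  `sliceFun_eq_zero_of_mem_add`, `sliceFun_eq_zero_of_nl_succ`, `semialgFun`, line bookkeeping.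
* `SliceInvariant.lean` (p96574): `sliceFun_nl_zero_apply`, `sliceFun_mem_of_nl_zero`,
  `closure_add_nl_le_comap_semialgFun` (rules (1a), (1b), (3) preserve the semialgebraic slice class).
* `SliceWitness.lean` (p96736): `hyperbolaRep`, `sliceFun_hyperbolaRep`,
  `exists_mem_changeOfVariablesRel_not_mem_closure_add_nl`, `closure_add_nl_lt_relations`
  (closure((1a)∪(1b)∪(3)) < relations — rule (2) is independent of rules (1), (3)),
  `exists_kernel_not_mem_closure_add_nl`, `not_ker_le_closure_add_nl`.
The theorems below are this work file's own copies (namespace `…Cruxes.OffTetraSectorKernel.Disproof`).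

## Findings — NO KILL (all theorems below are kernel-checked; 0 `sorry`)

* §1 SANDWICH. `of_summit : KontsevichZagierPeriods → OffTetraSectorKernel` and
  `kzKernelConjecture_of_sector : TetraSector → ZagierDilogarithmConjecture → OffTetraSectorKernel →
  KZKernelConjecture`; with the tree's `kzKernelConjecture_iff_isRational` the crux is EQUIVALENT
  to the summit modulo the (proved-minus-Zagier) sector (`iff_summit_of_sector`). CONSEQUENCE FOR
  DISPROVERS: `not_summit_of_not : ¬ crux → ¬ KontsevichZagierPeriods` — a kill of this crux is a
  disproof of the H21-literal period conjecture itself, i.e. exactly the open target `Neg.NegThesis`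
  of route Neg, for which no additive invariant is known (Neg rationale; HuberMullerStach2017
  Rem. 13.1.8). Every consequence of the crux is a consequence of the summit, so there is no
  cheaper angle.
* §2 SOUNDNESS SIDE. `sup_closure_le_ker : relations ⊔ closure (tetraRelators T) ≤ eval.ker` for
  EVERY family `T` (the adjoined relators evaluate to `0` by definition), hence the crux is the
  equality `relations ⊔ closure (tetraRelators stdFamily) = eval.ker` (`iff_eq_ker`); it is not made
  true by an overflowing closure, and not vacuous (the pinning hypothesis is satisfied by exactly
  one `T`, `eq_stdFamily`).
* §3 LOAD-BEARING HYPOTHESES.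
  - `false_without_evalZero`: dropping `eval c = 0` is false (witness `[piRep]`, value `π ≠ 0`).
  - `false_without_relations`: dropping the summand `relations ⊔` (kernel ⊆ closure of the tetra
    relators alone) is false: the dimension-`0` coefficient sum `dimZeroCoeff` kills every tetra
    relator (all live in dimension `3`) but not the kernel element `[∅₀]`.
  - `withoutFamily_iff_kzKernelConjecture`: dropping the pinning hypothesis `∀ z, T z = {…}`
    (quantifying over ALL families `T`) gives exactly `KZKernelConjecture` (instance `T ≡ ∅`:
    relators with null domains are already relations, tree lemma `KZ.of_mem_relations_of_volume_eq_zero`).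
    So the family hypothesis carries precisely the weight of the Bloch–Wigner sector, no more;
    it is "load-bearing" only to the extent `¬ KZKernelConjecture` is provable (open).
  - `false_without_newtonLeibniz` (§3b): deleting RULE (3) from the calculus makes the crux false —
    `dimTwoEval` (evaluate dimension-`2` generators only) is an invariant of (1a), (1b), (2) and of the
    dimension-`3` tetra relators, and is `−π` on the kernel element `[piRep.slab 0] − [piRep]` (ONE
    Newton–Leibniz instance). So the off-sector remainder needs Newton–Leibniz, unlike the sector
    (route rationale: "the line needs no Newton–Leibniz move at all"). Rules (1) and (2) cannot be
    isolated this cheaply: an invariant must also kill the tetra relators (see §7 (k)).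
* §4 OBSTRUCTION SHAPE. `not_of_invariant` / `exists_invariant_of_not`: `¬ crux` holds iff there is
  an additive `ι : FormalRep →+ A` vanishing on the four move sets AND on the tetra relators with
  `ι c ≠ 0` for some `c ∈ ker eval` (the quotient map is universal). Compared with
  `Neg.NegObstructionShape` the only extra demand is `ι = 0` on the dilogarithm value-relators.
* §5 STRENGTHENINGS. `sup_closure_ne_top` (target subgroup proper), `not_ker_le_closure_tetraRelators`
  (tetra closure alone does not exhaust the kernel); "drop the closure" is `KZKernelConjecture`
  (open, summit-equivalent: `kzKernelConjecture_iff_ker_le_relations`).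
* §6 CLOSED DOORS for `ι`: bounded-exponent targets vanish (`boundedExponent_invariant_vanishes`,
  from the divisibility of `FormalRep ⧸ relations`, ReducedPeriodRing/Negative/Certificates);
  `eval`-factoring `ι` vanish on the kernel; a torsion class of the quotient would be a kill
  (`not_of_torsion`) but needs the same non-membership certificate (`torsionFree_of` under the crux).
* §7 CANDIDATE INVARIANTS THAT DIE (prose census; why it resists):
  (a) any `ι [r] = ∫_σ f dμₙ` for other measures: rule (2) with arbitrary semialgebraic `Φ` forces
  `μₙ = cₙ·Lebesgue`, rule (3) forces `cₙ₊₁ = cₙ` ⇒ `ι = c·eval`; (b) dimension-weighted evaluation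
  `w(n)·value` survives (1a),(1b),(2) and dies on one Newton–Leibniz move (slab `[r] ~ [r × [0,1]]`,
  `KZ.IntegralRep.equivalent_slab`); (c) `KZ.coeffSum` survives (2),(3), dies on (1)
  (`KZSubcalculusInvariants`); (d) Euler-characteristic / constructible-function integration dies on
  the Jacobian factor of (2); (e) Galois twisting is unavailable: order pins the real roots, `Aut` of
  the real algebraic numbers is trivial, and all data are `ℚ`-definable; (f) non-archimedean
  (Kaiser-type) semialgebraic integration returns the standard value on parameter-free data;
  (g) truncation asymptotics at infinity are not preserved by (2) (`x ↦ 1/x`); (h) positive/negative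
  part splittings `∫ f⁺`, `∫_{f>0} f` survive (1a),(2) and die on (1b); (i) Hodge / motivic data cannot
  separate (the crux is implied by the summit, and every candidate identity in the tree — Gauss
  triplication `Neg.NegTriplicationNotAccessible`, Das-type square roots `Neg.CancellationGap` — is
  motivic); (j) decidability (`Barriers…not_complete_of_undecidable`) needs an undecidability proof
  for period equality that nobody has; (k) the `p₀`-SLICE CLASS `Λ[σ,f] = (x ↦ ∫_{σ ∩ {y₀ ≤ x}} f)`
  modulo `ℚ`-semialgebraic functions of `x` IS an invariant of (1a), (1b), (3) (rule (3) integrates the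
  last coordinate fibrewise over a `y₀`-cylinder; in dimension `1 → 0` the slice function is the
  semialgebraic primitive itself) and is NOT preserved by (2) — FORMALISED (sorry-free, standard axioms)
  in the companion file `Theorems/OffTetraSectorKernel/Negative/SliceInvariant.lean` (folder
  `NegSlice.lean`): `closure_add_nl_le_comap_semialgFun`, witness `hyperbolaRep` (region under
  `y₁(2 − y₀) < 1` over `(0,1)`) against its translate by `(1,0)` (`KZ.exists_translate`, ONE rule-(2)
  instance), slice function `log (2/(2−x))` on `(0,1)` (`sliceFun_hyperbolaRep`), contradiction with the
  barrier theorem `noSemialgebraicPrimitive_inv_sub_two_holds`; conclusions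
  `closure_add_nl_lt_relations : closure ((1a) ∪ (1b) ∪ (3)) < relations` and
  `not_ker_le_closure_add_nl` — rule (2) is independent of rules (1), (3), and every proof of the
  kernel conjecture must use it. But `Λ` does not kill the tetra relators (slice volumes of `T(z)` are
  dilogarithmic in `x`), so it says nothing for the
  crux with the closure adjoined. No kill: the crux resists because it is summit-strength (§1)
  and the only refutation template (§4) needs the missing invariant of route Neg.
* §8 SMALL MODELS. None: `FormalRep` is free abelian on an uncountable type and the moves quantify
  over all semialgebraic data; dimension-`0` generators are the real algebraic numbers, where every
  kernel element is a relation by integrand additivity alone. `decide`-style search is meaningless.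

Provers: cite `of_summit`, `iff_kzKernelConjecture_of_sector`, `sup_closure_le_ker`,
`withoutFamily_iff_kzKernelConjecture` freely (this file elaborates against the route file rev 6).
-/

set_option linter.dupNamespace false

noncomputable section

open MeasureTheory Set
open Literature.NumberTheory.Transcendental
open Summit.KontsevichZagierPeriods.KontsevichZagierPeriods.Theses.HyperbolicBloch

namespace Summit.KontsevichZagierPeriods.KontsevichZagierPeriods.Cruxes.OffTetraSectorKernel.Disproof

/-! ### §0 The objects of the crux, named -/

/-- The standard upper-half-space model of the ideal tetrahedron with vertices `∞, 0, 1, z`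
(the family pinned by the hypothesis `∀ z, T z = {…}` of every decl of the route). -/
def stdFamily : ℂ → Set (Fin 3 → ℝ) := fun z =>
  {p | 0 < p 1 ∧ z.re * p 1 < z.im * p 0 ∧ z.im * (p 0 - 1) < (z.re - 1) * p 1 ∧ 0 < p 2 ∧
    0 < z.im * (p 0 ^ 2 + p 1 ^ 2 + p 2 ^ 2 - p 0) + (z.re - Complex.normSq z) * p 1}

/-- The pinning hypothesis determines the family. -/
theorem eq_stdFamily {T : ℂ → Set (Fin 3 → ℝ)}
    (hT : ∀ z, T z = {p | 0 < p 1 ∧ z.re * p 1 < z.im * p 0 ∧ z.im * (p 0 - 1) < (z.re - 1) * p 1 ∧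
      0 < p 2 ∧ 0 < z.im * (p 0 ^ 2 + p 1 ^ 2 + p 2 ^ 2 - p 0) + (z.re - Complex.normSq z) * p 1}) :
    T = stdFamily :=
  funext hT

/-- The adjoined value-relators of a family `T`: ℤ-combinations of representations on the `T z`
(`z` algebraic, `Im z > 0`, integrand `t⁻³` on `T z`) whose values cancel. Verbatim the set under
`AddSubgroup.closure` in the crux. -/
def tetraRelators (T : ℂ → Set (Fin 3 → ℝ)) : Set KZ.FormalRep :=
  {d | ∃ ρ : ℂ → KZ.IntegralRep 3,
    (∀ z, IsAlgebraic ℚ z → 0 < z.im → (ρ z).domain = T z ∧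
      Set.EqOn (ρ z).integrand (fun p => 1 / p 2 ^ 3) (T z)) ∧
    ∃ (k : ℕ) (z : Fin k → ℂ) (n : Fin k → ℤ), (∀ i, IsAlgebraic ℚ (z i)) ∧ (∀ i, 0 < (z i).im) ∧
      ∑ i, (n i : ℝ) * (ρ (z i)).value = 0 ∧ d = ∑ i, n i • KZ.of (ρ (z i))}

/-- The crux at a given family, without the pinning idiom. -/
def KernelAt (T : ℂ → Set (Fin 3 → ℝ)) : Prop :=
  ∀ c : KZ.FormalRep, KZ.eval c = 0 → c ∈ KZ.relations ⊔ AddSubgroup.closure (tetraRelators T)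

/-- Unfolding: the crux is `KernelAt stdFamily`. -/
theorem offTetraSectorKernel_iff : OffTetraSectorKernel ↔ KernelAt stdFamily := by
  constructor
  · intro h c hc
    exact h stdFamily (fun _ => rfl) c hc
  · intro h T hT c hc
    rw [eq_stdFamily hT]
    exact h c hc

/-! ### §2 Soundness side: the target subgroup lies in the kernel, for every family -/

/-- Every adjoined relator evaluates to zero (by its defining cancellation), for ANY family `T`. -/
theorem tetraRelators_subset_ker (T : ℂ → Set (Fin 3 → ℝ)) :
    tetraRelators T ⊆ (KZ.eval.ker : Set KZ.FormalRep) := by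
  rintro d ⟨ρ, -, k, z, n, -, -, hsum, rfl⟩
  simp only [SetLike.mem_coe, AddMonoidHom.mem_ker, map_sum, map_zsmul, KZ.eval_of, zsmul_eq_mul]
  exact hsum

/-- `relations ⊔ closure (tetraRelators T) ≤ ker eval`: soundness of the calculus plus the
previous lemma. In particular the crux is not trivialised by an overflowing closure. -/
theorem sup_closure_le_ker (T : ℂ → Set (Fin 3 → ℝ)) :
    KZ.relations ⊔ AddSubgroup.closure (tetraRelators T) ≤ KZ.eval.ker :=
  sup_le KZ.relations_le_ker_eval_holds ((AddSubgroup.closure_le _).mpr (tetraRelators_subset_ker T))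

/-- The crux at `T` is the equality of subgroups `relations ⊔ closure (tetraRelators T) = ker eval`. -/
theorem kernelAt_iff_eq_ker (T : ℂ → Set (Fin 3 → ℝ)) :
    KernelAt T ↔ KZ.relations ⊔ AddSubgroup.closure (tetraRelators T) = KZ.eval.ker := by
  constructor
  · intro h
    exact le_antisymm (sup_closure_le_ker T) fun c hc => h c hc
  · intro h c hc
    rw [h]
    exact hc

/-- The crux is `relations ⊔ closure (tetraRelators stdFamily) = ker eval`. -/
theorem iff_eq_ker :
    OffTetraSectorKernel ↔
      KZ.relations ⊔ AddSubgroup.closure (tetraRelators stdFamily) = KZ.eval.ker :=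
  offTetraSectorKernel_iff.trans (kernelAt_iff_eq_ker _)

/-! ### §1 Sandwich: summit ⇒ crux ⇒ (sector ⇒ summit) -/

/-- The kernel conjecture implies the crux at every family (`AddSubgroup.mem_sup_left`). -/
theorem kernelAt_of_kzKernelConjecture (h : KZKernelConjecture) (T : ℂ → Set (Fin 3 → ℝ)) :
    KernelAt T :=
  fun c hc => AddSubgroup.mem_sup_left (h c hc)

/-- `KZKernelConjecture → OffTetraSectorKernel`. -/
theorem of_kzKernelConjecture (h : KZKernelConjecture) : OffTetraSectorKernel :=
  offTetraSectorKernel_iff.mpr (kernelAt_of_kzKernelConjecture h _)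

/-- **The summit implies the crux** (through the tree's `kzKernelConjecture_iff_isRational`, whose
right-hand side is verbatim the summit body). -/
theorem of_summit (h : _root_.KontsevichZagierPeriods) : OffTetraSectorKernel :=
  of_kzKernelConjecture (kzKernelConjecture_iff_isRational.mpr h)

/-- **A kill of the crux is a disproof of the summit.** -/
theorem not_summit_of_not (h : ¬ OffTetraSectorKernel) : ¬ _root_.KontsevichZagierPeriods :=
  fun hS => h (of_summit hS)

/-- Modulo the sector (TetraSector fed with Zagier's conjecture) the adjoined relators are already
relations, so the crux gives back the full kernel conjecture. This is the bookkeeping of the route's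
deciding theorem `closes`, stopped one step earlier. -/
theorem kzKernelConjecture_of_sector (hS : TetraSector) (hZ : ZagierDilogarithmConjecture)
    (hO : OffTetraSectorKernel) : KZKernelConjecture := by
  intro c hc
  have hmem := hO _ (fun z => rfl) c hc
  refine sup_le le_rfl ((AddSubgroup.closure_le _).mpr ?_) hmem
  rintro d ⟨ρ, hρ, k, z, nn, halg, him, hsum, rfl⟩
  exact hS _ (fun z => rfl) (hZ _ (fun z => rfl)) ρ hρ k z nn halg him hsum

/-- Modulo the sector, crux ⇔ kernel conjecture. -/
theorem iff_kzKernelConjecture_of_sector (hS : TetraSector) (hZ : ZagierDilogarithmConjecture) :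
    OffTetraSectorKernel ↔ KZKernelConjecture :=
  ⟨kzKernelConjecture_of_sector hS hZ, of_kzKernelConjecture⟩

/-- Modulo the sector, crux ⇔ summit. -/
theorem iff_summit_of_sector (hS : TetraSector) (hZ : ZagierDilogarithmConjecture) :
    OffTetraSectorKernel ↔ _root_.KontsevichZagierPeriods :=
  ⟨fun hO => closes hS hZ hO, of_summit⟩

/-! ### §3 Load-bearing hypotheses -/

/-- (H₁ = `eval c = 0`.) The crux with the kernel hypothesis dropped. -/
def WithoutEvalZero : Prop :=
  ∀ (T : ℂ → Set (Fin 3 → ℝ)), (∀ z, T z = {p | 0 < p 1 ∧ z.re * p 1 < z.im * p 0 ∧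
    z.im * (p 0 - 1) < (z.re - 1) * p 1 ∧ 0 < p 2 ∧
    0 < z.im * (p 0 ^ 2 + p 1 ^ 2 + p 2 ^ 2 - p 0) + (z.re - Complex.normSq z) * p 1}) →
  ∀ c : KZ.FormalRep, c ∈ KZ.relations ⊔ AddSubgroup.closure (tetraRelators T)

/-- **Any proof must use `eval c = 0`**: witness `c = [piRep]` (the closed unit disc with
integrand `1`, value `π`), which is not in the target subgroup because that subgroup lies in
`ker eval` (§2) and `π ≠ 0`. -/
theorem false_without_evalZero : ¬ WithoutEvalZero := by
  intro h
  have hmem := h stdFamily (fun _ => rfl) (KZ.of KZ.piRep)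
  have h0 : KZ.eval (KZ.of KZ.piRep) = 0 := sup_closure_le_ker stdFamily hmem
  rw [KZ.eval_of, KZ.piRep_value] at h0
  exact Real.pi_ne_zero h0

/-- (H₂ = the summand `relations ⊔`.) The crux with the move subgroup dropped: kernel elements lie
in the closure of the tetrahedral value-relators alone. -/
def WithoutRelations : Prop :=
  ∀ (T : ℂ → Set (Fin 3 → ℝ)), (∀ z, T z = {p | 0 < p 1 ∧ z.re * p 1 < z.im * p 0 ∧
    z.im * (p 0 - 1) < (z.re - 1) * p 1 ∧ 0 < p 2 ∧
    0 < z.im * (p 0 ^ 2 + p 1 ^ 2 + p 2 ^ 2 - p 0) + (z.re - Complex.normSq z) * p 1}) →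
  ∀ c : KZ.FormalRep, KZ.eval c = 0 → c ∈ AddSubgroup.closure (tetraRelators T)

/-- The dimension-`0` coefficient sum: the additive map sending a generator `[r]`, `r` of
dimension `n`, to `1` if `n = 0` and to `0` otherwise. It kills every tetra relator (all of
dimension `3`). -/
def dimZeroCoeff : KZ.FormalRep →+ ℤ :=
  FreeAbelianGroup.lift fun p => if p.1 = 0 then 1 else 0

@[simp] theorem dimZeroCoeff_of {n : ℕ} (r : KZ.IntegralRep n) :
    dimZeroCoeff (KZ.of r) = if n = 0 then 1 else 0 :=
  FreeAbelianGroup.lift_apply_of _ _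

/-- Tetra relators have dimension-`0` coefficient sum `0`. -/
theorem dimZeroCoeff_eq_zero_of_mem_tetraRelators (T : ℂ → Set (Fin 3 → ℝ)) {d : KZ.FormalRep}
    (hd : d ∈ tetraRelators T) : dimZeroCoeff d = 0 := by
  obtain ⟨ρ, -, k, z, n, -, -, -, rfl⟩ := hd
  simp

/-- The closure of the tetra relators lies in the kernel of `dimZeroCoeff`. -/
theorem closure_tetraRelators_le_ker_dimZeroCoeff (T : ℂ → Set (Fin 3 → ℝ)) :
    AddSubgroup.closure (tetraRelators T) ≤ dimZeroCoeff.ker :=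
  (AddSubgroup.closure_le _).mpr fun _ hd => dimZeroCoeff_eq_zero_of_mem_tetraRelators T hd

/-- **Any proof must use the move subgroup**: the kernel element `[∅₀]` (empty representation in
dimension `0`, value `0`) has dimension-`0` coefficient sum `1`, so it is not in the closure of the
tetra relators. (It IS a relation: `KZ.IntegralRep.of_empty_mem_relations`.) -/
theorem false_without_relations : ¬ WithoutRelations := by
  intro h
  have hmem := h stdFamily (fun _ => rfl) (KZ.of (KZ.IntegralRep.empty 0)) (by simp)
  have h0 := closure_tetraRelators_le_ker_dimZeroCoeff stdFamily hmem
  rw [AddMonoidHom.mem_ker, dimZeroCoeff_of] at h0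
  simp at h0

/-- (H₃ = the pinning hypothesis `∀ z, T z = {…}`.) The crux with the family left free. -/
def WithoutFamily : Prop :=
  ∀ (T : ℂ → Set (Fin 3 → ℝ)) (c : KZ.FormalRep),
    KZ.eval c = 0 → c ∈ KZ.relations ⊔ AddSubgroup.closure (tetraRelators T)

/-- For the EMPTY family every adjoined relator is already a relation (null domains). -/
theorem closure_tetraRelators_empty_le :
    AddSubgroup.closure (tetraRelators fun _ => ∅) ≤ KZ.relations := by
  refine (AddSubgroup.closure_le _).mpr ?_
  rintro d ⟨ρ, hρ, k, z, n, halg, him, -, rfl⟩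
  refine AddSubgroup.sum_mem _ fun i _ => AddSubgroup.zsmul_mem _ ?_ _
  exact KZ.of_mem_relations_of_volume_eq_zero _ (by rw [(hρ (z i) (halg i) (him i)).1, measure_empty])

/-- At the empty family the crux IS the kernel conjecture. -/
theorem kernelAt_empty_iff : KernelAt (fun _ => ∅) ↔ KZKernelConjecture := by
  constructor
  · intro h c hc
    exact sup_le le_rfl closure_tetraRelators_empty_le (h c hc)
  · intro h
    exact kernelAt_of_kzKernelConjecture h _

/-- **Dropping the pinning hypothesis turns the crux into `KZKernelConjecture` itself** — so the
family hypothesis is load-bearing exactly to the extent that the Bloch–Wigner sector is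
(cf. `iff_kzKernelConjecture_of_sector`). Not refutable here: that would be `¬ KZKernelConjecture`. -/
theorem withoutFamily_iff_kzKernelConjecture : WithoutFamily ↔ KZKernelConjecture :=
  ⟨fun h => kernelAt_empty_iff.mp (fun c hc => h _ c hc),
    fun h T c hc => kernelAt_of_kzKernelConjecture h T c hc⟩

/-! ### §3b Rule (3) of the calculus is load-bearing: evaluation in dimension two only -/

/-- Evaluation of the dimension-`2` generators only: `[r] ↦ value r` if `r` has dimension `2`,
`↦ 0` otherwise. It is an invariant of the three dimension-preserving moves (1a), (1b), (2) and
of the tetra relators (dimension `3`), but not of Newton–Leibniz. [folklore] -/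
def dimTwoEval : KZ.FormalRep →+ ℝ :=
  FreeAbelianGroup.lift fun p => if p.1 = 2 then p.2.value else 0

/-- `dimTwoEval` on a generator. [folklore] -/
@[simp] theorem dimTwoEval_of {n : ℕ} (r : KZ.IntegralRep n) :
    dimTwoEval (KZ.of r) = if n = 2 then r.value else 0 :=
  FreeAbelianGroup.lift_apply_of _ _

/-- On a three-term combination in one dimension, `dimTwoEval` is `eval` or `0`. [folklore] -/
theorem dimTwoEval_sub_sub {n : ℕ} (r r₁ r₂ : KZ.IntegralRep n) :
    dimTwoEval (KZ.of r - KZ.of r₁ - KZ.of r₂) =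
      if n = 2 then KZ.eval (KZ.of r - KZ.of r₁ - KZ.of r₂) else 0 := by
  simp only [map_sub, dimTwoEval_of, KZ.eval_of]
  split_ifs <;> simp

/-- On a two-term combination in one dimension, `dimTwoEval` is `eval` or `0`. [folklore] -/
theorem dimTwoEval_sub {n : ℕ} (r r' : KZ.IntegralRep n) :
    dimTwoEval (KZ.of r - KZ.of r') = if n = 2 then KZ.eval (KZ.of r - KZ.of r') else 0 := by
  simp only [map_sub, dimTwoEval_of, KZ.eval_of]
  split_ifs <;> simp

/-- Domain additivity preserves `dimTwoEval`. [cite: KontsevichZagier2001, §1.2 rule (1)] -/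
theorem dimTwoEval_eq_zero_of_mem_domainAddRel {c : KZ.FormalRep} (hc : c ∈ KZ.domainAddRel) :
    dimTwoEval c = 0 := by
  have h0 : KZ.eval c = 0 := KZ.eval_eq_zero_of_mem_domainAddRel_holds hc
  obtain ⟨n, r, r₁, r₂, -, -, -, -, rfl⟩ := hc
  rw [dimTwoEval_sub_sub, h0]
  simp

/-- Integrand additivity preserves `dimTwoEval`. [cite: KontsevichZagier2001, §1.2 rule (1)] -/
theorem dimTwoEval_eq_zero_of_mem_integrandAddRel {c : KZ.FormalRep} (hc : c ∈ KZ.integrandAddRel) :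
    dimTwoEval c = 0 := by
  have h0 : KZ.eval c = 0 := KZ.eval_eq_zero_of_mem_integrandAddRel_holds hc
  obtain ⟨n, r, r₁, r₂, -, -, -, rfl⟩ := hc
  rw [dimTwoEval_sub_sub, h0]
  simp

/-- Change of variables preserves `dimTwoEval`. [cite: KontsevichZagier2001, §1.2 rule (2)] -/
theorem dimTwoEval_eq_zero_of_mem_changeOfVariablesRel {c : KZ.FormalRep}
    (hc : c ∈ KZ.changeOfVariablesRel) : dimTwoEval c = 0 := by
  have h0 : KZ.eval c = 0 := KZ.eval_eq_zero_of_mem_changeOfVariablesRel_holds hc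
  obtain ⟨n, r, r', Φ, Φ', -, -, -, -, -, rfl⟩ := hc
  rw [dimTwoEval_sub, h0]
  simp

/-- Tetra relators (dimension `3`) have `dimTwoEval = 0`. [folklore] -/
theorem dimTwoEval_eq_zero_of_mem_tetraRelators (T : ℂ → Set (Fin 3 → ℝ)) {d : KZ.FormalRep}
    (hd : d ∈ tetraRelators T) : dimTwoEval d = 0 := by
  obtain ⟨ρ, -, k, z, n, -, -, -, rfl⟩ := hd
  simp

/-- The crux WITH RULE (3) DELETED: kernel elements lie in the subgroup generated by the three
dimension-preserving moves (1a), (1b), (2) together with the tetra relators. -/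
def WithoutNewtonLeibniz : Prop :=
  ∀ (T : ℂ → Set (Fin 3 → ℝ)), (∀ z, T z = {p | 0 < p 1 ∧ z.re * p 1 < z.im * p 0 ∧
    z.im * (p 0 - 1) < (z.re - 1) * p 1 ∧ 0 < p 2 ∧
    0 < z.im * (p 0 ^ 2 + p 1 ^ 2 + p 2 ^ 2 - p 0) + (z.re - Complex.normSq z) * p 1}) →
  ∀ c : KZ.FormalRep, KZ.eval c = 0 →
    c ∈ AddSubgroup.closure (KZ.domainAddRel ∪ KZ.integrandAddRel ∪ KZ.changeOfVariablesRel) ⊔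
      AddSubgroup.closure (tetraRelators T)

/-- **Any proof of the crux must use the Newton–Leibniz move.** The kernel element
`[piRep.slab 0] − [piRep]` (the cylinder `{x²+y² ≤ 1} × [0,1]` with integrand `1` against the
disc; it IS one rule-(3) instance, `KZ.IntegralRep.of_slab_sub_of_mem_newtonLeibnizRel`) has
`dimTwoEval = −π ≠ 0`, while `dimTwoEval` kills (1a), (1b), (2) and every tetra relator.
In particular the off-sector remainder is NOT reachable by the scissors-type sub-calculus that
suffices for the sector itself (route rationale: "the line needs no Newton–Leibniz move"). [folklore] -/
theorem false_without_newtonLeibniz :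
    ¬ WithoutNewtonLeibniz := by
  intro h
  have hNL := KZ.IntegralRep.of_slab_sub_of_mem_newtonLeibnizRel KZ.piRep 0
  have hc : KZ.eval (KZ.of (KZ.piRep.slab 0) - KZ.of KZ.piRep) = 0 :=
    KZ.relations_le_ker_eval_holds (KZ.newtonLeibnizRel_subset_relations hNL)
  have hmem := h stdFamily (fun _ => rfl) _ hc
  have hle : AddSubgroup.closure (KZ.domainAddRel ∪ KZ.integrandAddRel ∪ KZ.changeOfVariablesRel) ⊔
      AddSubgroup.closure (tetraRelators stdFamily) ≤ dimTwoEval.ker := by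
    refine sup_le ((AddSubgroup.closure_le _).mpr ?_) ((AddSubgroup.closure_le _).mpr ?_)
    · rintro x ((hx | hx) | hx)
      · exact dimTwoEval_eq_zero_of_mem_domainAddRel hx
      · exact dimTwoEval_eq_zero_of_mem_integrandAddRel hx
      · exact dimTwoEval_eq_zero_of_mem_changeOfVariablesRel hx
    · intro x hx
      exact dimTwoEval_eq_zero_of_mem_tetraRelators stdFamily hx
  have h0 := hle hmem
  rw [AddMonoidHom.mem_ker, map_sub, dimTwoEval_of, dimTwoEval_of, KZ.piRep_value] at h0
  simp at h0

/-! ### §4 Obstruction shape: what a disproof must be -/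

/-- **Template.** An additive invariant killing the four move sets and the tetra relators, non-zero
on one kernel element, refutes the crux. (Compared with `Neg.NegObstructionShape` the only extra
demand is the vanishing on the dilogarithm value-relators.) -/
theorem not_of_invariant {A : Type*} [AddCommGroup A] (ι : KZ.FormalRep →+ A)
    (hmoves : ∀ c ∈ KZ.domainAddRel ∪ KZ.integrandAddRel ∪ KZ.changeOfVariablesRel ∪
      KZ.newtonLeibnizRel, ι c = 0)
    (htetra : ∀ d ∈ tetraRelators stdFamily, ι d = 0)
    (c : KZ.FormalRep) (hc : KZ.eval c = 0) (hι : ι c ≠ 0) : ¬ OffTetraSectorKernel := by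
  intro hO
  have hmem := offTetraSectorKernel_iff.mp hO c hc
  have hle : KZ.relations ⊔ AddSubgroup.closure (tetraRelators stdFamily) ≤ ι.ker :=
    sup_le ((AddSubgroup.closure_le _).mpr fun x hx => hmoves x hx)
      ((AddSubgroup.closure_le _).mpr fun x hx => htetra x hx)
  exact hι (hle hmem)

/-- **Converse (universality of the quotient).** If the crux fails, the quotient map by the target
subgroup is such an invariant. So §4 is the exact shape of any kill. -/
theorem exists_invariant_of_not (h : ¬ OffTetraSectorKernel) :
    ∃ ι : KZ.FormalRep →+ KZ.FormalRep ⧸ (KZ.relations ⊔ AddSubgroup.closure (tetraRelators stdFamily)),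
      (∀ c ∈ KZ.domainAddRel ∪ KZ.integrandAddRel ∪ KZ.changeOfVariablesRel ∪ KZ.newtonLeibnizRel,
        ι c = 0) ∧ (∀ d ∈ tetraRelators stdFamily, ι d = 0) ∧
      ∃ c : KZ.FormalRep, KZ.eval c = 0 ∧ ι c ≠ 0 := by
  set N := KZ.relations ⊔ AddSubgroup.closure (tetraRelators stdFamily) with hN
  refine ⟨QuotientAddGroup.mk' N, ?_, ?_, ?_⟩
  · intro c hc
    exact (QuotientAddGroup.eq_zero_iff c).mpr
      (AddSubgroup.mem_sup_left (AddSubgroup.subset_closure hc))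
  · intro d hd
    exact (QuotientAddGroup.eq_zero_iff d).mpr
      (AddSubgroup.mem_sup_right (AddSubgroup.subset_closure hd))
  · by_contra hall
    push Not at hall
    apply h
    rw [offTetraSectorKernel_iff]
    intro c hc
    exact (QuotientAddGroup.eq_zero_iff c).mp (hall c hc)

/-! ### §5 Natural strengthenings that ARE false (and the one that is open) -/

/-- The target subgroup is proper (it misses `[piRep]`): the crux is not the triviality
`relations ⊔ closure = ⊤`. -/
theorem sup_closure_ne_top (T : ℂ → Set (Fin 3 → ℝ)) :
    KZ.relations ⊔ AddSubgroup.closure (tetraRelators T) ≠ ⊤ := by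
  intro h
  have hmem : KZ.of KZ.piRep ∈ KZ.relations ⊔ AddSubgroup.closure (tetraRelators T) := by
    rw [h]; trivial
  have h0 : KZ.eval (KZ.of KZ.piRep) = 0 := sup_closure_le_ker T hmem
  rw [KZ.eval_of, KZ.piRep_value] at h0
  exact Real.pi_ne_zero h0

/-- Strengthening "closure of the tetra relators alone exhausts the kernel" is false
(`2•[∅₀]`-type witnesses; here `[∅₀]`). -/
theorem not_ker_le_closure_tetraRelators (T : ℂ → Set (Fin 3 → ℝ)) :
    ¬ (KZ.eval.ker ≤ AddSubgroup.closure (tetraRelators T)) := by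
  intro h
  have hmem : KZ.of (KZ.IntegralRep.empty 0) ∈ KZ.eval.ker := by simp [AddMonoidHom.mem_ker]
  have h0 := closure_tetraRelators_le_ker_dimZeroCoeff T (h hmem)
  rw [AddMonoidHom.mem_ker, dimZeroCoeff_of] at h0
  simp at h0

/-- The strengthening "drop the closure" is `KZKernelConjecture` (open, summit-equivalent):
recorded as an implication only. -/
theorem kzKernelConjecture_iff_ker_le_relations :
    KZKernelConjecture ↔ KZ.eval.ker ≤ KZ.relations :=
  ⟨fun h c hc => h c hc, fun h _ hc => h hc⟩

/-! ### §6 Closed doors for the missing invariant (cheap structural constraints)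

Any kill is an additive `ι` as in §4. The following classes of `ι` are excluded outright. -/

/-- **No finite / parity / counting invariant can kill the crux**: an additive map killing
`KZ.relations` with values in a group of bounded exponent vanishes identically, because
`FormalRep ⧸ relations` is divisible (`[σ, f] ∼ N • [σ, f/N]`,
`ReducedPeriodRingNegative.exists_sub_nsmul_mem_relations`). -/
theorem boundedExponent_invariant_vanishes {A : Type*} [AddCommGroup A] (ι : KZ.FormalRep →+ A)
    (hι : ∀ c ∈ KZ.relations, ι c = 0) {N : ℕ} (hN : 0 < N) (hA : ∀ a : A, N • a = 0)
    (c : KZ.FormalRep) : ι c = 0 :=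
  Summit.KontsevichZagierPeriods.KontsevichZagierPeriods.ReducedPeriodRingNegative.bounded_exponent_certificate_vanishes
    ι hι hN hA c

/-- **No invariant factoring through the value can kill the crux** (it vanishes on the kernel). -/
theorem evalFactoring_invariant_vanishes {A : Type*} [AddCommGroup A] (g : ℝ →+ A)
    (c : KZ.FormalRep) (hc : KZ.eval c = 0) : g.comp KZ.eval c = 0 := by
  rw [AddMonoidHom.comp_apply, hc, map_zero]

/-- **A torsion class of `FormalRep ⧸ (relations ⊔ closure tetra)` would be a kill** (its lift is a
kernel element outside the target subgroup, `eval` being `ℤ`-torsion-free) — but exhibiting one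
needs the same non-membership certificate; and under the crux the quotient embeds in `ℝ`, so it is
torsion-free. Recorded as the implication. -/
theorem not_of_torsion (c : KZ.FormalRep) {k : ℕ} (hk : 0 < k)
    (hkc : k • c ∈ KZ.relations ⊔ AddSubgroup.closure (tetraRelators stdFamily))
    (hc : c ∉ KZ.relations ⊔ AddSubgroup.closure (tetraRelators stdFamily)) :
    ¬ OffTetraSectorKernel := by
  intro hO
  have h0 : KZ.eval (k • c) = 0 := sup_closure_le_ker stdFamily hkc
  rw [map_nsmul, nsmul_eq_mul, mul_eq_zero] at h0
  rcases h0 with h0 | h0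
  · exact (Nat.cast_ne_zero.mpr hk.ne') h0
  · exact hc (offTetraSectorKernel_iff.mp hO c h0)

/-- **Under the crux the target subgroup is an ideal-like set for the product of representations**
is NOT recorded here (it needs `KZProduct`'s ring structure on classes); what IS cheap: under the
crux, `relations ⊔ closure tetra = ker eval` is the kernel of a homomorphism to `ℝ`, hence the
quotient is torsion-free — the contrapositive of `not_of_torsion`. -/
theorem torsionFree_of (hO : OffTetraSectorKernel) (c : KZ.FormalRep) {k : ℕ} (hk : 0 < k)
    (hkc : k • c ∈ KZ.relations ⊔ AddSubgroup.closure (tetraRelators stdFamily)) :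
    c ∈ KZ.relations ⊔ AddSubgroup.closure (tetraRelators stdFamily) := by
  by_contra hc
  exact not_of_torsion c hk hkc hc hO


end Summit.KontsevichZagierPeriods.KontsevichZagierPeriods.Cruxes.OffTetraSectorKernel.Disproof
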